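import Mathlib
import HarnessLib
import Literature.RepresentationTheory.CompactGroups.WeylIntegralFormula
import Literature.LinearAlgebra.Matrix.NormalMatrixSpectralTheorem
import Literature.MathematicalPhysics.QuantumLattice.GaugeGroups
import Summits.Ventures.LatticeQCDFlow.Exactness.SubgroupProductHaar
import Summits.Ventures.LatticeQCDFlow.Exactness.SpectralCouplingMeasurable
import Summits.Ventures.LatticeQCDFlow.Exactness.SpectralCouplingLayerExactness
import Summits.Ventures.LatticeQCDFlow.Exactness.SpectralKernelJacobianWeylShapeSU

/-!
# The `SU(N)` spectral coupling layer with a density that is only a MEASURABLE function of the spectrum (no continuity of `j`), unconditional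

HONEST FRAMING: exact (Metropolis-corrected) sampling algorithms for lattice gauge theory;
figures of merit are autocorrelation/cost numbers at stated couplings and volumes; no
continuum-physics claim.

Venture `LatticeQCDFlow` (cell pub-lqcd), topic `Exactness`; FANOUT row 10 (`eng-equiv`, engine
`latflow.equiv` `spectral.spectral_coupling_layer`).  NEW WORK of the cell.  The layer theorems of this
topic (`hasJacobian_spectralCouplingLayer_specialUnitary_of_weylFact` and its descendants, e.g. the booked
`SU(3)` / `SU(N)` layer theorems) ask the booked density `j a y : SU(N) → ℝ` to be JOINTLY CONTINUOUS in
(frozen context, link).  The engine's booked density `|Δ(x')|²/|Δ(x)|² · (cell Jacobian)` is NOT continuous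
on `SU(N)` (it is undefined-by-continuity at the walls `|Δ| = 0`, a Haar-null set), only a measurable
function of the spectrum.  This file removes the continuity hypothesis: joint MEASURABILITY of the
spectral datum `jD a : Y × (n → ℂ) → ℝ` suffices, because a function of `(y, W)` that is, in every unitary
diagonalization `W = V·diag d·V⋆`, equal to `jD a y d` is jointly Borel (Suslin: its sub-level sets and
their complements are continuous images of Borel subsets of the Polish space `Y × SU(N) × SU(N)`).
Weyl's integral formula enters as the tree's THEOREM `weylIntegralFormula_specialUnitary_holds`
(so nothing here is conditional); nothing is cited as a fact; no number; no definition.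

## What is typed (`Y` Polish, e.g. the frozen context `({i // ¬p i} → SU(N))`)

* `preimage_eq_image_conj_of_spectral_jointly`, **`measurable_of_spectral_jointly`** —
  `(y, W) ↦ J y W` is measurable once `J y W = JD y d` in every unitary diagonalization and
  `(y, d) ↦ JD y d` is measurable;
* **`hasJacobian_spectralCouplingLayer_specialUnitary_of_spectralDensity`** — the `SU(N)` spectral
  coupling layer is an exact transport of `⊗ Haar` with Jacobian `Theory2.coupleJac p (j at the loops)`,
  for per-link torus Jacobians `hfJ` with Boyda's identity `hJ`, the density `j` being ANY non-negative
  function with a jointly measurable spectral datum `jD` (`hjspec`), NO continuity of `j`.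
-/

noncomputable section

namespace Summit.Ventures.LatticeQCDFlow.Exactness

open MeasureTheory Matrix Set Topology
open Literature.LinearAlgebra.Matrix
open Literature.MathematicalPhysics.QuantumFieldTheory
open Literature.RepresentationTheory.CompactGroups
open scoped ENNReal

variable {n : Type} [Fintype n] [DecidableEq n]

section Jointly

variable {Y : Type*} [TopologicalSpace Y] [PolishSpace Y] [MeasurableSpace Y] [BorelSpace Y]

omit [TopologicalSpace Y] [PolishSpace Y] [MeasurableSpace Y] [BorelSpace Y] in
/-- **`{(y, W) : J y W ∈ B}` as a continuous image.**  If `J y W = JD y d` in every unitary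
diagonalization `W = V·diag d·V⋆`, then the preimage of `B` under `(y, W) ↦ J y W` is the image of
`{(y, V, T) : T diagonal, JD y (diag T) ∈ B}` under `(y, V, T) ↦ (y, V T V⁻¹)`. -/
theorem preimage_eq_image_conj_of_spectral_jointly {β : Type*} {JD : Y → (n → ℂ) → β}
    {J : Y → Matrix.specialUnitaryGroup n ℂ → β}
    (hJspec : ∀ (y : Y) (W : Matrix.specialUnitaryGroup n ℂ) (V : Matrix n n ℂ) (d : n → ℂ),
      V ∈ Matrix.unitaryGroup n ℂ → (W : Matrix n n ℂ) = V * diagonal d * star V → J y W = JD y d)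
    (B : Set β) :
    (fun q : Y × Matrix.specialUnitaryGroup n ℂ => J q.1 q.2) ⁻¹' B =
      (fun q : Y × (Matrix.specialUnitaryGroup n ℂ × Matrix.specialUnitaryGroup n ℂ) =>
          (q.1, q.2.1 * q.2.2 * q.2.1⁻¹)) ''
        {q | (∀ i j, i ≠ j → ((q.2.2 : Matrix.specialUnitaryGroup n ℂ) : Matrix n n ℂ) i j = 0) ∧
          JD q.1 (fun i => ((q.2.2 : Matrix.specialUnitaryGroup n ℂ) : Matrix n n ℂ) i i) ∈ B} := by
  ext ⟨y, W⟩
  constructor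
  · intro hW
    -- the spectral theorem with a conjugator in `SU(N)`
    have hWu : (W : Matrix n n ℂ) ∈ Matrix.unitaryGroup n ℂ := (Matrix.mem_specialUnitaryGroup_iff.mp W.2).1
    have hWn : IsStarNormal (W : Matrix n n ℂ) :=
      ⟨by rw [Commute, SemiconjBy, Matrix.mem_unitaryGroup_iff'.mp hWu, Matrix.mem_unitaryGroup_iff.mp hWu]⟩
    obtain ⟨V, hV, d, hd⟩ :=
      Literature.LinearAlgebra.Matrix.exists_specialUnitaryGroup_forall_conj_eq_diagonal_of_commute_of_isStarNormal
        (fun _ : Unit => (W : Matrix n n ℂ)) (fun _ => hWn) (fun _ _ => Commute.refl _)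
    set V' : Matrix.specialUnitaryGroup n ℂ := ⟨V, hV⟩ with hV'
    set T : Matrix.specialUnitaryGroup n ℂ := V'⁻¹ * W * V' with hTdef
    have hT : (T : Matrix n n ℂ) = diagonal (d ()) := hd ()
    have hVu : V ∈ Matrix.unitaryGroup n ℂ := (Matrix.mem_specialUnitaryGroup_iff.mp hV).1
    have h2 : V * star V = 1 := Matrix.mem_unitaryGroup_iff.mp hVu
    have hWd : (W : Matrix n n ℂ) = V * diagonal (fun i => (T : Matrix n n ℂ) i i) * star V := by
      have hdiag : (fun i => (T : Matrix n n ℂ) i i) = d () := funext fun i => by rw [hT, diagonal_apply_eq]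
      rw [hdiag]
      calc (W : Matrix n n ℂ) = (V * star V) * (W : Matrix n n ℂ) * (V * star V) := by
            rw [h2, Matrix.one_mul, Matrix.mul_one]
        _ = V * (star V * (W : Matrix n n ℂ) * V) * star V := by simp only [Matrix.mul_assoc]
        _ = V * diagonal (d ()) * star V := by rw [hd ()]
    refine ⟨(y, (V', T)), ⟨fun i j hij => by rw [hT, diagonal_apply_ne _ hij], ?_⟩, ?_⟩
    · show JD y (fun i => (T : Matrix n n ℂ) i i) ∈ B
      rw [← hJspec y W V _ hVu hWd]
      exact hW
    · show (y, V' * T * V'⁻¹) = (y, W)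
      rw [hTdef]
      congr 1
      group
  · rintro ⟨⟨y', V, T⟩, ⟨hT, hB⟩, hq⟩
    simp only [Prod.mk.injEq] at hq
    obtain ⟨rfl, rfl⟩ := hq
    show J y' (V * T * V⁻¹) ∈ B
    have hVu : (V : Matrix n n ℂ) ∈ Matrix.unitaryGroup n ℂ := (Matrix.mem_specialUnitaryGroup_iff.mp V.2).1
    have hTd : (T : Matrix n n ℂ) = diagonal fun i => (T : Matrix n n ℂ) i i := by
      ext i j
      by_cases hij : i = j
      · subst hij
        rw [diagonal_apply_eq]
      · rw [diagonal_apply_ne _ hij, hT i j hij]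
    have hcoe : (((V * T * V⁻¹ : Matrix.specialUnitaryGroup n ℂ)) : Matrix n n ℂ) =
        (V : Matrix n n ℂ) * diagonal (fun i => (T : Matrix n n ℂ) i i) * star (V : Matrix n n ℂ) := by
      rw [← hTd]
      rfl
    rw [hJspec _ _ _ _ hVu hcoe]
    exact hB

/-- **Joint measurability of a spectral density.**  `Y` Polish; `J : Y → SU(N) → β` with
`J y W = JD y d` in every unitary diagonalization, `(y, d) ↦ JD y d` measurable ⇒ `(y, W) ↦ J y W`
measurable. -/
theorem measurable_of_spectral_jointly {β : Type*} [MeasurableSpace β] {JD : Y → (n → ℂ) → β}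
    (hJDm : Measurable fun q : Y × (n → ℂ) => JD q.1 q.2)
    {J : Y → Matrix.specialUnitaryGroup n ℂ → β}
    (hJspec : ∀ (y : Y) (W : Matrix.specialUnitaryGroup n ℂ) (V : Matrix n n ℂ) (d : n → ℂ),
      V ∈ Matrix.unitaryGroup n ℂ → (W : Matrix n n ℂ) = V * diagonal d * star V → J y W = JD y d) :
    Measurable fun q : Y × Matrix.specialUnitaryGroup n ℂ => J q.1 q.2 := by
  haveI : SecondCountableTopology (Matrix n n ℂ) := inferInstanceAs (SecondCountableTopology (n → n → ℂ))
  haveI : SecondCountableTopology (Matrix.specialUnitaryGroup n ℂ) :=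
    Topology.IsEmbedding.subtypeVal.secondCountableTopology
  intro B hB
  have hΨ : Continuous fun q : Y × (Matrix.specialUnitaryGroup n ℂ × Matrix.specialUnitaryGroup n ℂ) =>
      (q.1, q.2.1 * q.2.2 * q.2.1⁻¹) :=
    continuous_fst.prodMk (((continuous_fst.comp continuous_snd).mul (continuous_snd.comp continuous_snd)).mul
      (continuous_fst.comp continuous_snd).inv)
  have hentry : ∀ i j, Continuous
      fun q : Y × (Matrix.specialUnitaryGroup n ℂ × Matrix.specialUnitaryGroup n ℂ) =>
        ((q.2.2 : Matrix.specialUnitaryGroup n ℂ) : Matrix n n ℂ) i j := fun i j => by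
    have h1 : Continuous fun q : Y × (Matrix.specialUnitaryGroup n ℂ × Matrix.specialUnitaryGroup n ℂ) =>
        ((q.2.2 : Matrix.specialUnitaryGroup n ℂ) : Matrix n n ℂ) :=
      continuous_subtype_val.comp (continuous_snd.comp continuous_snd)
    exact (continuous_apply j).comp ((continuous_apply i).comp h1)
  have hS : ∀ C : Set β, MeasurableSet C → MeasurableSet
      {q : Y × (Matrix.specialUnitaryGroup n ℂ × Matrix.specialUnitaryGroup n ℂ) |
        (∀ i j, i ≠ j → ((q.2.2 : Matrix.specialUnitaryGroup n ℂ) : Matrix n n ℂ) i j = 0) ∧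
          JD q.1 (fun i => ((q.2.2 : Matrix.specialUnitaryGroup n ℂ) : Matrix n n ℂ) i i) ∈ C} := by
    intro C hC
    have hdiag : MeasurableSet {q : Y × (Matrix.specialUnitaryGroup n ℂ × Matrix.specialUnitaryGroup n ℂ) |
        ∀ i j, i ≠ j → ((q.2.2 : Matrix.specialUnitaryGroup n ℂ) : Matrix n n ℂ) i j = 0} := by
      have hset : {q : Y × (Matrix.specialUnitaryGroup n ℂ × Matrix.specialUnitaryGroup n ℂ) |
          ∀ i j, i ≠ j → ((q.2.2 : Matrix.specialUnitaryGroup n ℂ) : Matrix n n ℂ) i j = 0} =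
          ⋂ i, ⋂ j, {q | i ≠ j → ((q.2.2 : Matrix.specialUnitaryGroup n ℂ) : Matrix n n ℂ) i j = 0} := by
        ext q
        simp only [mem_setOf_eq, mem_iInter]
      rw [hset]
      refine MeasurableSet.iInter fun i => MeasurableSet.iInter fun j => ?_
      by_cases hij : i = j
      · have h0 : {q : Y × (Matrix.specialUnitaryGroup n ℂ × Matrix.specialUnitaryGroup n ℂ) |
            i ≠ j → ((q.2.2 : Matrix.specialUnitaryGroup n ℂ) : Matrix n n ℂ) i j = 0} = univ := by
          ext q
          simp [hij]
        rw [h0]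
        exact MeasurableSet.univ
      · have h0 : {q : Y × (Matrix.specialUnitaryGroup n ℂ × Matrix.specialUnitaryGroup n ℂ) |
            i ≠ j → ((q.2.2 : Matrix.specialUnitaryGroup n ℂ) : Matrix n n ℂ) i j = 0} =
            {q | ((q.2.2 : Matrix.specialUnitaryGroup n ℂ) : Matrix n n ℂ) i j = 0} := by
          ext q
          simp [hij]
        rw [h0]
        exact (isClosed_eq (hentry i j) continuous_const).measurableSet
    rw [setOf_and]
    exact hdiag.inter ((hJDm.comp (measurable_fst.prodMk
      (measurable_pi_lambda _ fun i => (hentry i i).measurable))) hC)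
  have hA : ∀ C : Set β, MeasurableSet C →
      AnalyticSet ((fun q : Y × Matrix.specialUnitaryGroup n ℂ => J q.1 q.2) ⁻¹' C) := fun C hC => by
    rw [preimage_eq_image_conj_of_spectral_jointly hJspec C]
    exact (hS C hC).analyticSet_image hΨ.measurable
  exact (hA B hB).measurableSet_of_compl (by rw [← preimage_compl]; exact hA Bᶜ hB.compl)

end Jointly

/-! ## The layer theorem without continuity of the density -/

/-- **`SU(N)` spectral coupling layer, density only a measurable function of the spectrum.**  As
`hasJacobian_spectralCouplingLayer_specialUnitary_of_weylFact` (staples `S a` continuous, eigenvalue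
maps `f a` jointly continuous on context × unimodular torus, kernels `h a y` following the spectral
recipe, per-link torus maps `fT a y` with torus Jacobians `JfT a y` and Boyda's identity `hJ`), but the
density `j a y : SU(N) → ℝ` is only required to be non-negative and to have a JOINTLY MEASURABLE
spectral datum `jD a` (`j a y W = jD a y d` whenever `W = V·diag d·V⋆`, `V` unitary) — no continuity
of `j`; and Weyl's formula is the tree's theorem, so the result is unconditional. -/
theorem hasJacobian_spectralCouplingLayer_specialUnitary_of_spectralDensity {ι : Type*} [Fintype ι]
    (p : ι → Prop) [DecidablePred p]
    (S : {i // p i} → ({i // ¬p i} → Matrix.specialUnitaryGroup n ℂ) → Matrix.specialUnitaryGroup n ℂ)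
    (hS : ∀ a, Continuous (S a))
    (f : {i // p i} → ({i // ¬p i} → Matrix.specialUnitaryGroup n ℂ) → (n → ℂ) → (n → ℂ))
    (hf : ∀ a, ContinuousOn
      (fun q : ({i // ¬p i} → Matrix.specialUnitaryGroup n ℂ) × (n → ℂ) => f a q.1 q.2)
      {q | ∀ i, ‖q.2 i‖ = 1})
    (h : {i // p i} → ({i // ¬p i} → Matrix.specialUnitaryGroup n ℂ) →
      Matrix.specialUnitaryGroup n ℂ → Matrix.specialUnitaryGroup n ℂ)
    (hagree : ∀ a y (P : Matrix.specialUnitaryGroup n ℂ) (V : Matrix n n ℂ) (d : n → ℂ),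
      V ∈ Matrix.unitaryGroup n ℂ → (P : Matrix n n ℂ) = V * diagonal d * star V →
        ((h a y P : Matrix.specialUnitaryGroup n ℂ) : Matrix n n ℂ) = V * diagonal (f a y d) * star V)
    (fT : {i // p i} → ({i // ¬p i} → Matrix.specialUnitaryGroup n ℂ) →
      specialDiagonalTorus n → specialDiagonalTorus n)
    (hfT : ∀ a y (t : specialDiagonalTorus n),
      ((fT a y t : Matrix.specialUnitaryGroup n ℂ) : Matrix n n ℂ) =
        diagonal (f a y fun i => ((t : Matrix.specialUnitaryGroup n ℂ) : Matrix n n ℂ) i i))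
    (JfT : {i // p i} → ({i // ¬p i} → Matrix.specialUnitaryGroup n ℂ) → specialDiagonalTorus n → ℝ≥0∞)
    (hfJ : ∀ a y, HasJacobian (haarProbability (specialDiagonalTorus n)) (fT a y) (JfT a y))
    (j : {i // p i} → ({i // ¬p i} → Matrix.specialUnitaryGroup n ℂ) → Matrix.specialUnitaryGroup n ℂ → ℝ)
    (hj0 : ∀ a y g, 0 ≤ j a y g)
    (jD : {i // p i} → ({i // ¬p i} → Matrix.specialUnitaryGroup n ℂ) → (n → ℂ) → ℝ)
    (hjDm : ∀ a, Measurable fun q : ({i // ¬p i} → Matrix.specialUnitaryGroup n ℂ) × (n → ℂ) => jD a q.1 q.2)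
    (hjspec : ∀ a y (W : Matrix.specialUnitaryGroup n ℂ) (V : Matrix n n ℂ) (d : n → ℂ),
      V ∈ Matrix.unitaryGroup n ℂ → (W : Matrix n n ℂ) = V * diagonal d * star V → j a y W = jD a y d)
    (hJ : ∀ a y (g : Matrix.specialUnitaryGroup n ℂ) (t : specialDiagonalTorus n),
      ENNReal.ofReal (j a y (g * (t : Matrix.specialUnitaryGroup n ℂ) * g⁻¹)) * ENNReal.ofReal
          ((∏ i, ∏ k ∈ Finset.univ.erase i,
            ‖((t : Matrix.specialUnitaryGroup n ℂ) : Matrix n n ℂ) i i -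
              ((t : Matrix.specialUnitaryGroup n ℂ) : Matrix n n ℂ) k k‖) / (Fintype.card n).factorial) =
        JfT a y t * ENNReal.ofReal
          ((∏ i, ∏ k ∈ Finset.univ.erase i,
            ‖((fT a y t : Matrix.specialUnitaryGroup n ℂ) : Matrix n n ℂ) i i -
              ((fT a y t : Matrix.specialUnitaryGroup n ℂ) : Matrix n n ℂ) k k‖) / (Fintype.card n).factorial)) :
    HasJacobian (Measure.pi fun _ : ι => haarProbability (Matrix.specialUnitaryGroup n ℂ))
      (Theory2.coupleFun p fun a y u => h a y (u * S a y) * (u * S a y)⁻¹ * u)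
      fun U => ENNReal.ofReal (Theory2.coupleJac p (fun a y u => j a y (u * S a y)) U) := by
  haveI : SecondCountableTopology (Matrix n n ℂ) := inferInstanceAs (SecondCountableTopology (n → n → ℂ))
  haveI : SecondCountableTopology (Matrix.specialUnitaryGroup n ℂ) :=
    Topology.IsEmbedding.subtypeVal.secondCountableTopology
  -- the density is jointly measurable in (context, link), link read at the loop
  have hjm : ∀ a, Measurable fun q : ({i // ¬p i} → Matrix.specialUnitaryGroup n ℂ) × Matrix.specialUnitaryGroup n ℂ =>
      j a q.1 q.2 := fun a => measurable_of_spectral_jointly (hjDm a) (hjspec a)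
  have hjloop : ∀ a, Measurable fun q : Matrix.specialUnitaryGroup n ℂ × ({i // ¬p i} → Matrix.specialUnitaryGroup n ℂ) =>
      j a q.2 (q.1 * S a q.2) := fun a =>
    (hjm a).comp (measurable_snd.prodMk (measurable_fst.mul ((hS a).measurable.comp measurable_snd)))
  have hjslice : ∀ a y, Measurable fun g : Matrix.specialUnitaryGroup n ℂ => ENNReal.ofReal (j a y g) := fun a y =>
    ENNReal.measurable_ofReal.comp ((hjm a).comp (measurable_const.prodMk measurable_id))
  exact hasJacobian_kernelCouplingLayer p S h j
    (fun a => measurable_spectralKernelUpdate_specialUnitaryGroup (hf a) (hagree a) (hS a)) hjloop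
    (fun a y => hasJacobian_spectralKernel_specialUnitaryGroup_of_weyl (weylIntegralFormula_specialUnitary_holds n)
      (continuousOn_slice_of_jointly (hf a) y) (hagree a y) (hfT a y) (hfJ a y) (hjslice a y) (hJ a y))
    hj0

end Summit.Ventures.LatticeQCDFlow.Exactness
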